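import Summits.QuantumFields.YangMills.Theorems.BalabanUVNodesN22W1ActivityStrip
import Literature.MathematicalPhysics.QuantumFieldTheory.Balaban1983to89.Node00.HistoryTermsOfRecord

/-!
# BalabanUVNodes ∕ node N22 = NE9 — THE INDUCTION ON THE LEVEL AT THE W1 OBJECT ON THE YOUNG-COUPLING STRIP: (2.40)–(2.41) of [II] p. 21
# closing «the inductive assumption (1.18) for k+1» ([II] p. 21–22) with ONE COUPLING COMPLEXIFIED, from ONE displayed one-step hypothesis
# of printed shape at TERM level (N10's Lemmas 1–3 read on the strip), by S25's proved transport on the torus; (1.18) one run as a corollary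

Cell `pub-ymgap`, HUMAN RULING D-0062 (Track A), R134 ACCELERATION re-seat `pub-ymgap-dag-n22-c` (strategy s1: «the history-Lipschitz estimate
(2.40)–(2.41) p. 21 of [II] on the W1 object»), generation 2, module 1 of 2.  THEOREMS ONLY (no `def`, no `def … : Prop`); imports generation 0's
W1 activity-strip module `…N22W1ActivityStrip` (p457296; through it the slot module p452837 and S25
`DressedOutputAnalyticFaces.analytic_and_bounded_locE_param_torus`) and the W1 OBJECT `Node00.HistoryTermsOfRecord` (p455641) BY NAME.
`--supports` the K3 item of route `BalabanUVNodes`.  Module 2 (`…N22W1StripInductionLetters`) carries the letters for the `S_N22` slots.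

WHY (generation 0's located residual (ii), one printed level down).  Generation 0 instanced N22 at the W1 object from a LEVEL-WISE displayed
hypothesis `youngHolo` («at every step `k` the activities `(S k).H` are strip-holomorphic in each young coupling under one (2.38)-majorant
`A·e^{−R d}`», free letters at every level).  Print does not assume (2.38) level by level: it PROVES it inductively — [II] p. 15 «To get a bound for
H(Z) we consider a term in the sum over 𝐃, P … (2.14) …» is estimated THROUGH THE OLD TERMS `E^{(j)}`, `j ≤ k`, by the inductive assumption (1.18)
((2.15): through «|V_k(Y, B)|» only), giving (2.26); Lemma 3 resums (2.26) to (2.38); (2.39)–(2.41) p. 21 transport (2.38) to `|E^{(k+1)}(X)| ≤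
O(1)C₃ε₁e^{−(1−10δ)½Lκ d_{k+1}(X)}` — «This completes the proof of the inductive assumption (1.18) for k+1» (p. 21–22) once `O(1)C₃ε₁ ≤ E₀`.  An
OLDER coupling `g_i`, `i < k`, enters the step-`k` term (2.14) ONLY through the old terms ([I] p. 256; [II] (2.15) p. 15), so the same three
printed moves run VERBATIM when `E^{(j)}(·; g | g_i := z)`, `i < j ≤ k`, are replaced by holomorphic extensions in `z` obeying (1.18) on a strip:
THIS is the located unprinted content of N22 on ROAD 3 («N10's T-row read on a strip»), and it is ONE STEP of an induction whose transport move
is a kernel theorem of the tree (S25; Lemma 3's resummation is folded into the displayed step, its input being print's «by assertion» analytic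
content (2.15)–(2.26)).  THIS FILE runs that induction at the object: the displayed hypothesis is the ONE-STEP, TERM-LEVEL `hprop`; the rest is proved.

WHAT.  Write STRIP(j, i; E₀, κ) at `(g, Y, ψ)` for «`∃ (Ec : ℂ → ℂ) (O : Set ℂ)`, `O` open ⊇ the closed `r`-discs about `]0, γ]`, `Ec` holomorphic on
`O`, `‖Ec z‖ ≤ E₀·e^{−κ·d_j(Y)}` on `O`, `Ec t = W1.termC S j Y (g | g_i := t) ψ` for `t ∈ ]0, γ]`» — (1.18) for the level-`j` term with the `i`-th
coupling complexified on the strip (the shape of generation 0's `youngHolo` ∕ n22-d's `EHoloAt` letters; for `i ≥ j` the term does not read `g_i`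
and STRIP is the real (1.18)).
* §1 `stripBound_termC_of_stepOut` — THE INDUCTION ON THE LEVEL (bookkeeping only): a one-step OUTPUT-level hypothesis «STRIP at all levels `≤ k`
  in coupling `i ≤ k` (all domains, all configurations of the space table) ⇒ STRIP(k+1, i) on `sp (k+1) X`» ⟹ STRIP(j, i) for EVERY level `j`
  and EVERY coupling `i` (level `0`: no term, [I] (0.23); couplings `i ≥ j`: constant extension by `W1.termC_congr_prefix`, the real bound read
  off a disc centre).
* §2 `strip_succ_of_complexifiedTerms` — ONE STEP AT ONE POINT: complexified (2.14) terms, holomorphic on an open `O ⊇` the discs, under the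
  RESUMMED (2.26)-majorant `Σ_{j ∈ idx Z} ‖Tc j z‖ ≤ A·e^{−R·d_{k+1}(Z)}` ⟹ STRIP(k+1, i), by S25 `analytic_and_bounded_locE_param_torus` BY NAME
  ((2.38) → (2.41) on `𝐃_{k+1}` of record = `tsys 4 (domCount (F.P K) M (k+1))`, incompatibility `TTouch`, footprint `(·.1)`; numerals `r₁ +
  2·64·log 162 + 2 ≤ R`, `A·e^{5r₁+1}·K₀(64,8)·9·64 ≤ 1`, `κ ≤ r₁`) + the amplitude renewal `e·9·64·K₀(64,8)²·A ≤ E₀` (print: `O(1)C₃ε₁ ≤ E₀`),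
  (2.13) being DEFINITIONAL in W1 (`E_eq_locE`, `termC_succ`); `stepOut_of_propagation` — the displayed TERM-LEVEL one-step hypothesis `hprop`
  «STRIP at levels `≤ k` in coupling `i ≤ k` ⇒ such families `Tc`» ((2.15)–(2.26) + (2.28)–(2.37): N10's Lemmas 1–3 on the strip) ⟹ §1's
  hypothesis; `stripBound_termC_of_propagation` = §2 ∘ §1: `hprop` + numerals ⟹ STRIP at every level in every coupling.
* §3 COROLLARIES: `termBound118_of_stripBound` — **(1.18) ITSELF, one run**: `W1.TermBound118 S (Window γ) sp E₀ κ`;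
  `decayBound_functionalOn_of_termBound118` — `T4OutputRate.DecayBound (W1.functionalOn S p emb) (Window γ) E₀ κ` for backgrounds read inside
  the spaces (`|Re z| ≤ ‖z‖`; [I] p. 263 «the configurations … restricted to X belong to U^c_j» is Theorem-1 content, displayed as `hsp`).
* §4 `propagation_termlessTower` — NON-VACUITY (A5 rider): the termless model tower carries `hprop` (model tower, NOT NODE 00's).

HONEST FRAMING.  Count-neutral by-name knit AT THE OBJECT; NOT a discharge of N22.  `hprop` is DISPLAYED and asserted nowhere: for the OLDER
couplings it is [II] (2.15)–(2.26) + (2.28)–(2.37) read with the old terms replaced by their strip extensions (NOT PRINTED as such — inspection-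
level: `g_i`, `i < k`, is read through the old terms only), for the LAST coupling it is the [H-dil] ∕ [I] p. 266–267 content (NOT PRINTED with a
domain; module 2 separates it as an output-level letter of node N09's lane); the W1 object is a hypothesis-schema whose index sets and term
values are DATA (ref-H WATCH-W1-DEGENERATE: a discharge at a tower not pinned to N10's (2.14) terms of record is junk-shaped — §4 is exactly such
a model witness and is labelled so).  NE9 NOT IN PRINT, NOT PROVED; one finite four-torus programme at fixed ε — NOT infinite volume, NOT OS on
ℝ⁴, NOT a mass gap, NOT Clay.  0 `sorry`, 0 `def`, standard axioms.

References (TYPES only): [I] = [Balaban1987RG1] T. Bałaban, Commun. Math. Phys. **109** (1987) 249–301 — (0.23) p. 256, (1.18) p. 263, p. 266–267;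
[II] = [Balaban1988RG2Cluster] T. Bałaban, Commun. Math. Phys. **116** (1988) 1–22 — (2.13)–(2.15) pp. 14–15, (2.26) p. 17, Lemma 3 (2.38) p. 20,
(2.39)–(2.41) p. 21, p. 21–22; [KoteckyPreiss1986] Thm p. 492.
-/

noncomputable section

namespace YMDAG.N22.W1

open Set Metric
open scoped BigOperators
open Literature.MathematicalPhysics.QuantumFieldTheory.Balaban1983to89
open Literature.MathematicalPhysics.QuantumFieldTheory.Balaban1983to89.T4Continuum (T4Family)
open Literature.MathematicalPhysics.QuantumFieldTheory.Balaban1983to89.T4OutputRate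
open Literature.MathematicalPhysics.QuantumFieldTheory.Balaban1983to89.B13Resummation (locE)
open Literature.MathematicalPhysics.QuantumFieldTheory.Balaban1983to89.TreeLengthTorus (TPt TDom tsys torusTreeLen torusTreeLen_nonneg)
open Literature.MathematicalPhysics.QuantumFieldTheory.Balaban1983to89.TreeLengthTorusGeometry (TTouch)
open Literature.MathematicalPhysics.QuantumFieldTheory.Balaban1983to89.B12TreeDecay (K₀ K₀_pos)
open Literature.MathematicalPhysics.QuantumFieldTheory.Balaban1983to89.Node00
open Literature.MathematicalPhysics.QuantumFieldTheory.Balaban1983to89.Node00.Sect2 (domSys domCount CPair ofBackgroundC)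
open Literature.MathematicalPhysics.QuantumFieldTheory.Balaban1983to89.Node00.W1
open Summit.QuantumFields.BalabanUV.T4Continuum.NE1p.DressedOutputAnalyticFaces (analytic_and_bounded_locE_param_torus)

variable (F : T4Family) (K : ℕ) {𝔸 : Type*} {M : ℕ}

/-! ## §1 The induction on the level (bookkeeping): a one-step output-level hypothesis ⟹ STRIP at every level in every coupling -/

/-- **THE INDUCTION ON THE LEVEL.**  For W1's tower `S`, a space table `sp`, the window `]0, γ]`, a disc radius `r ≥ 0` and letters `E₀ ≥ 0`, `κ`:
IF for every step `k`, window history `g`, coupling `i ≤ k`, domain `X ∈ 𝐃_{k+1}` and configuration `φ ∈ sp (k+1) X`, STRIP at all levels `j ≤ k` in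
coupling `i` (every domain, every configuration of the table) implies STRIP(k+1, i) at `(g, X, φ)` — the ONE-STEP output-level hypothesis `hstep`
([II] p. 21–22 «completes the proof of the inductive assumption (1.18) for k+1», produced from the term-level hypothesis by §2) — THEN STRIP(j, i) holds
at EVERY level `j` in EVERY coupling `i`: level `0` has no term ([I] (0.23)); a coupling `i ≥ j` is not read by the level-`j` term ([I] p. 256,
`W1.termC_congr_prefix`), whose real value — read off the centre `g₀` of a disc of STRIP(j, 0) when `j ≥ 1` — extends as a constant. [folklore] -/
theorem stripBound_termC_of_stepOut {P : Params} (S : ClusterTower P 𝔸 M) (sp : (j : ℕ) → (domSys P M j).Dom → Set (CPair P 𝔸))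
    {γ r E₀ κ : ℝ} (hr : 0 ≤ r) (hE₀ : 0 ≤ E₀)
    (hstep : ∀ (k : ℕ) (g : ℕ → ℝ), g ∈ Window γ → ∀ (i : ℕ), i < k + 1 → ∀ (X : (domSys P M (k + 1)).Dom) (φ : CPair P 𝔸),
      φ ∈ sp (k + 1) X →
      (∀ (j : ℕ), j < k + 1 → ∀ (Y : (domSys P M j).Dom) (ψ : CPair P 𝔸), ψ ∈ sp j Y →
        ∃ (Ec : ℂ → ℂ) (O : Set ℂ), IsOpen O ∧ (∀ t ∈ Ioc (0 : ℝ) γ, closedBall (t : ℂ) r ⊆ O) ∧ DifferentiableOn ℂ Ec O ∧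
          (∀ z ∈ O, ‖Ec z‖ ≤ E₀ * Real.exp (-(κ * torusTreeLen Y.1))) ∧
          (∀ t ∈ Ioc (0 : ℝ) γ, Ec t = termC S j Y (Function.update g i t) ψ)) →
      ∃ (Ec : ℂ → ℂ) (O : Set ℂ), IsOpen O ∧ (∀ t ∈ Ioc (0 : ℝ) γ, closedBall (t : ℂ) r ⊆ O) ∧ DifferentiableOn ℂ Ec O ∧
        (∀ z ∈ O, ‖Ec z‖ ≤ E₀ * Real.exp (-(κ * torusTreeLen X.1))) ∧
        (∀ t ∈ Ioc (0 : ℝ) γ, Ec t = termC S (k + 1) X (Function.update g i t) φ)) :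
    ∀ (j : ℕ) (g : ℕ → ℝ), g ∈ Window γ → ∀ (i : ℕ) (Y : (domSys P M j).Dom) (ψ : CPair P 𝔸), ψ ∈ sp j Y →
      ∃ (Ec : ℂ → ℂ) (O : Set ℂ), IsOpen O ∧ (∀ t ∈ Ioc (0 : ℝ) γ, closedBall (t : ℂ) r ⊆ O) ∧ DifferentiableOn ℂ Ec O ∧
        (∀ z ∈ O, ‖Ec z‖ ≤ E₀ * Real.exp (-(κ * torusTreeLen Y.1))) ∧
        (∀ t ∈ Ioc (0 : ℝ) γ, Ec t = termC S j Y (Function.update g i t) ψ) := by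
  -- strong induction on the level, packaged as `∀ n, ∀ j ≤ n, …`
  suffices h : ∀ (n j : ℕ), j ≤ n → ∀ (g : ℕ → ℝ), g ∈ Window γ → ∀ (i : ℕ) (Y : (domSys P M j).Dom) (ψ : CPair P 𝔸), ψ ∈ sp j Y →
      ∃ (Ec : ℂ → ℂ) (O : Set ℂ), IsOpen O ∧ (∀ t ∈ Ioc (0 : ℝ) γ, closedBall (t : ℂ) r ⊆ O) ∧ DifferentiableOn ℂ Ec O ∧
        (∀ z ∈ O, ‖Ec z‖ ≤ E₀ * Real.exp (-(κ * torusTreeLen Y.1))) ∧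
        (∀ t ∈ Ioc (0 : ℝ) γ, Ec t = termC S j Y (Function.update g i t) ψ) from
    fun j => h j j le_rfl
  -- the constant extension of a value already bounded
  have hconst : ∀ (j : ℕ) (g : ℕ → ℝ) (i : ℕ) (Y : (domSys P M j).Dom) (ψ : CPair P 𝔸),
      ‖termC S j Y g ψ‖ ≤ E₀ * Real.exp (-(κ * torusTreeLen Y.1)) →
      (∀ t ∈ Ioc (0 : ℝ) γ, termC S j Y (Function.update g i t) ψ = termC S j Y g ψ) →
      ∃ (Ec : ℂ → ℂ) (O : Set ℂ), IsOpen O ∧ (∀ t ∈ Ioc (0 : ℝ) γ, closedBall (t : ℂ) r ⊆ O) ∧ DifferentiableOn ℂ Ec O ∧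
        (∀ z ∈ O, ‖Ec z‖ ≤ E₀ * Real.exp (-(κ * torusTreeLen Y.1))) ∧
        (∀ t ∈ Ioc (0 : ℝ) γ, Ec t = termC S j Y (Function.update g i t) ψ) := by
    intro j g i Y ψ hb hupd
    exact ⟨fun _ => termC S j Y g ψ, Set.univ, isOpen_univ, fun t _ => subset_univ _, differentiableOn_const _,
      fun z _ => hb, fun t ht => (hupd t ht).symm⟩
  intro n
  induction n with
  | zero =>
    intro j hj g _ i Y ψ _
    obtain rfl : j = 0 := Nat.le_zero.mp hj
    refine hconst 0 g i Y ψ ?_ fun t _ => ?_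
    · rw [termC_zero, norm_zero]; positivity
    · rw [termC_zero, termC_zero]
  | succ n ih =>
    intro j hj g hg i Y ψ hψ
    rcases Nat.lt_succ_iff_lt_or_eq.mp (Nat.lt_succ_of_le hj) with hjn | rfl
    · exact ih j (Nat.lt_succ_iff.mp hjn) g hg i Y ψ hψ
    · -- level `n + 1`: the couplings `i ≤ n` by the one-step hypothesis fed with the induction hypothesis
      have hlt : ∀ (i : ℕ), i < n + 1 →
          ∃ (Ec : ℂ → ℂ) (O : Set ℂ), IsOpen O ∧ (∀ t ∈ Ioc (0 : ℝ) γ, closedBall (t : ℂ) r ⊆ O) ∧ DifferentiableOn ℂ Ec O ∧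
            (∀ z ∈ O, ‖Ec z‖ ≤ E₀ * Real.exp (-(κ * torusTreeLen Y.1))) ∧
            (∀ t ∈ Ioc (0 : ℝ) γ, Ec t = termC S (n + 1) Y (Function.update g i t) ψ) := fun i hi =>
        hstep n g hg i hi Y ψ hψ fun j hj Y' ψ' hψ' => ih j (Nat.lt_succ_iff.mp hj) g hg i Y' ψ' hψ'
      by_cases hi : i < n + 1
      · exact hlt i hi
      · -- a coupling `i ≥ n + 1` is not read at level `n + 1`: real bound off the disc centre `g 0` of STRIP(n+1, 0), constant extension
        obtain ⟨Ec, O, -, hdisc, -, hB, hrep⟩ := hlt 0 (Nat.succ_pos n)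
        have hg0 : g 0 ∈ Ioc (0 : ℝ) γ := hg 0
        have hmem : ((g 0 : ℝ) : ℂ) ∈ O := hdisc (g 0) hg0 (mem_closedBall_self hr)
        refine hconst (n + 1) g i Y ψ ?_ fun t _ => ?_
        · have h := hB _ hmem
          rwa [hrep (g 0) hg0, Function.update_eq_self] at h
        · exact termC_congr_prefix S (n + 1) Y (g := Function.update g i t) (g' := g)
            (fun m hm => Function.update_of_ne (by omega) _ _) ψ

/-! ## §2 The one-step output hypothesis from the TERM-LEVEL propagation hypothesis, by S25's transport (2.38) → (2.41) on the torus -/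

open Classical in
/-- **ONE STEP AT ONE POINT: complexified terms under the resummed (2.26)-majorant ⟹ STRIP(k+1, i)** (S25 BY NAME).  At a fixed step `k`, history `g`,
coupling `i`, domain `X ∈ 𝐃_{k+1}` of the record's torus catalogue (`P := F.P K`: `𝐃_{k+1} = tsys 4 (domCount (F.P K) M (k+1))`, `d = torusTreeLen`) and
configuration `φ`: complexified term families `Tc j`, holomorphic on an open `O ⊇` the closed `r`-discs about `]0, γ]`, with `Σ_{j ∈ idx Z} ‖Tc j z‖ ≤
A·e^{−R·d_{k+1}(Z)}` on `O` for `Z ⊆ X` and `Tc j t = (S k).T j (g | g_i := t)|_{≤k} φ` at real `t`, give — under S25's located numerals `r₁ + 2·64·log 162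
+ 2 ≤ R`, `A·e^{5r₁+1}·K₀(64,8)·9·64 ≤ 1`, `κ ≤ r₁` and the amplitude renewal `e·9·64·K₀(64,8)²·A ≤ E₀` (print's `O(1)C₃ε₁ ≤ E₀`) — STRIP(k+1, i) at
`(g, X, φ)`: the activities `Hc z Z := Σ_{j ∈ idx Z} Tc j z` ((2.11)) are holomorphic under the one majorant, S25 `analytic_and_bounded_locE_param_torus`
makes `z ↦ Σ_{K: ∪K = X} Φ^T(K; Hc z)` ((2.13), `B13Resummation.locE` on `TTouch`) holomorphic on `O` with `‖·‖ ≤ e·9·64·K₀²·A·e^{−r₁ d(X)} ≤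
E₀·e^{−κ d(X)}` ((2.39)–(2.41)), and at real `t` it IS `E^{(k+1)}(X; g | g_i := t; φ) = W1.termC S (k+1) X (g | g_i := t) φ` ((2.13) DEFINITIONAL in
W1: `ClusterStep.E_eq_locE`, `termC_succ`). [folklore] -/
theorem strip_succ_of_complexifiedTerms (S : ClusterTower (F.P K) 𝔸 M) {γ r E₀ κ A R r₁ : ℝ} (hA0 : 0 ≤ A) (hr₁ : 0 ≤ r₁) (hκ : κ ≤ r₁)
    (hrate : r₁ + 2 * (64 * Real.log 162) + 2 ≤ R) (hsmall : A * Real.exp (5 * r₁ + 1) * K₀ 64 8 * 9 * 64 ≤ 1)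
    (hrenew : Real.exp 1 * 9 * 64 * K₀ 64 8 ^ 2 * A ≤ E₀) (k : ℕ) (g : ℕ → ℝ) (i : ℕ) (X : (domSys (F.P K) M (k + 1)).Dom)
    (φ : CPair (F.P K) 𝔸) (Tc : (S k).Idx → ℂ → ℂ) (O : Set ℂ) (hO : IsOpen O) (hdisc : ∀ t ∈ Ioc (0 : ℝ) γ, closedBall (t : ℂ) r ⊆ O)
    (hhol : ∀ Z : (domSys (F.P K) M (k + 1)).Dom, Z.1 ⊆ X.1 → ∀ j ∈ (S k).idx Z, DifferentiableOn ℂ (Tc j) O)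
    (hmaj : ∀ z ∈ O, ∀ Z : (domSys (F.P K) M (k + 1)).Dom, Z.1 ⊆ X.1 →
      ∑ j ∈ (S k).idx Z, ‖Tc j z‖ ≤ A * Real.exp (-(R * torusTreeLen Z.1)))
    (hrepT : ∀ t ∈ Ioc (0 : ℝ) γ, ∀ j, Tc j t = (S k).T j (restrictPrefix k (Function.update g i t)) φ) :
    ∃ (Ec : ℂ → ℂ) (O : Set ℂ), IsOpen O ∧ (∀ t ∈ Ioc (0 : ℝ) γ, closedBall (t : ℂ) r ⊆ O) ∧ DifferentiableOn ℂ Ec O ∧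
      (∀ z ∈ O, ‖Ec z‖ ≤ E₀ * Real.exp (-(κ * torusTreeLen X.1))) ∧
      (∀ t ∈ Ioc (0 : ℝ) γ, Ec t = termC S (k + 1) X (Function.update g i t) φ) := by
  -- the complexified activities (2.11) and S25's transport (2.38) → (2.41) on the torus catalogue of record
  have key := analytic_and_bounded_locE_param_torus (N := domCount (F.P K) M (k + 1)) (P := ℂ)
    (m := fun Z : (tsys 4 (domCount (F.P K) M (k + 1))).Dom => A * Real.exp (-(R * torusTreeLen Z.1)))
    (act := fun z Z => ∑ j ∈ (S k).idx Z, Tc j z) (A := A) (R := R) (r₁ := r₁) X hO hA0 hr₁ hrate hsmall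
    (fun Z hZ => DifferentiableOn.fun_sum fun j hj => hhol Z hZ j hj)
    (fun z hz Z hZ => (norm_sum_le _ _).trans (hmaj z hz Z hZ)) (fun Z _ => le_rfl)
  have hM : 0 ≤ Real.exp 1 * 9 * 64 * K₀ 64 8 ^ 2 * A := by positivity
  refine ⟨fun z => locE (TTouch (d := 4) (N := domCount (F.P K) M (k + 1)))
      (fun Z : (tsys 4 (domCount (F.P K) M (k + 1))).Dom => Z.1) (fun Z => ∑ j ∈ (S k).idx Z, Tc j z) X.1,
    O, hO, hdisc, key.1, fun z hz => ?_, fun t ht => ?_⟩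
  · calc ‖locE (TTouch (d := 4) (N := domCount (F.P K) M (k + 1))) (fun Z : (tsys 4 (domCount (F.P K) M (k + 1))).Dom => Z.1)
            (fun Z => ∑ j ∈ (S k).idx Z, Tc j z) X.1‖
        ≤ Real.exp 1 * 9 * 64 * K₀ 64 8 ^ 2 * A * Real.exp (-(r₁ * torusTreeLen X.1)) := key.2 z hz
      _ ≤ E₀ * Real.exp (-(κ * torusTreeLen X.1)) :=
          mul_le_mul hrenew (Real.exp_le_exp.2 (neg_le_neg (mul_le_mul_of_nonneg_right hκ (torusTreeLen_nonneg _))))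
            (Real.exp_nonneg _) (le_trans hM hrenew)
  · -- (2.13) is definitional: `termC S (k+1) X g' φ = (S k).E g'|_{≤k} φ X = locE TTouch (·.1) ((S k).H g'|_{≤k} φ ·) X.1`
    have hH : (fun Z : TDom 4 (domCount (F.P K) M (k + 1)) => ∑ j ∈ (S k).idx Z, Tc j (t : ℂ)) =
        fun Z => (S k).H (restrictPrefix k (Function.update g i t)) φ Z := by
      funext Z
      simp only [ClusterStep.H]
      exact Finset.sum_congr rfl fun j _ => hrepT t ht j
    exact (congrArg (fun w : TDom 4 (domCount (F.P K) M (k + 1)) → ℂ =>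
      locE (TTouch (d := 4) (N := domCount (F.P K) M (k + 1)))
        (fun Z : (tsys 4 (domCount (F.P K) M (k + 1))).Dom => Z.1) w X.1) hH).trans rfl

open Classical in
/-- **THE ROW'S CONTENT: ONE STEP OF THE INDUCTION ON THE STRIP, (2.40)–(2.41) AT THE W1 OBJECT.**  For W1's tower `S` on the record's torus catalogue
(`P := F.P K`, so `𝐃_{k+1} = tsys 4 (domCount (F.P K) M (k+1))`, `d = torusTreeLen`): IF `hprop` — for every step `k`, window history `g`, coupling
`i ≤ k`, domain `X ∈ 𝐃_{k+1}`, configuration `φ ∈ sp (k+1) X`: STRIP at all levels `j ≤ k` in coupling `i` (the inductive assumption (1.18) on the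
strip, all domains, all configurations of the table) IMPLIES that the TERMS (2.14) of step `k` admit complexified families `Tc j : ℂ → ℂ`, holomorphic
on an open `O ⊇` the closed `r`-discs about `]0, γ]`, with the RESUMMED (2.26) majorant `Σ_{j ∈ idx Z} ‖Tc j z‖ ≤ A·e^{−R·d_{k+1}(Z)}` on `O` for the
polymers `Z ⊆ X`, and `Tc j t = (S k).T j (g | g_i := t)|_{≤ k} φ` for real `t` ([II] (2.15)–(2.26) + Lemma 3's (2.28)–(2.37) READ ON THE STRIP —
DISPLAYED, asserted nowhere) — THEN, under S25's located numerals `r₁ + 2·64·log 162 + 2 ≤ R`, `A·e^{5r₁+1}·K₀(64,8)·9·64 ≤ 1`, `κ ≤ r₁` and the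
amplitude renewal `e·9·64·K₀(64,8)²·A ≤ E₀` (print's `O(1)C₃ε₁ ≤ E₀`), §1's one-step OUTPUT hypothesis holds: the activities `Hc z Z := Σ_{j ∈ idx Z}
Tc j z` ((2.11)) are holomorphic under the one majorant, S25 `analytic_and_bounded_locE_param_torus` makes `z ↦ Σ_{K: ∪K = X} Φ^T(K; Hc z)` ((2.13),
`B13Resummation.locE` on `TTouch`) holomorphic on `O` with `‖·‖ ≤ e·9·64·K₀²·A·e^{−r₁ d(X)} ≤ E₀·e^{−κ d(X)}`, and at real `t` it IS
`E^{(k+1)}(X; g | g_i := t; φ) = W1.termC S (k+1) X (g | g_i := t) φ` ((2.13) DEFINITIONAL in W1: `ClusterStep.E_eq_locE`, `termC_succ`). [folklore] -/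
theorem stepOut_of_propagation (S : ClusterTower (F.P K) 𝔸 M) (sp : (j : ℕ) → (domSys (F.P K) M j).Dom → Set (CPair (F.P K) 𝔸))
    {γ r E₀ κ A R r₁ : ℝ} (hA0 : 0 ≤ A) (hr₁ : 0 ≤ r₁) (hκ : κ ≤ r₁) (hrate : r₁ + 2 * (64 * Real.log 162) + 2 ≤ R)
    (hsmall : A * Real.exp (5 * r₁ + 1) * K₀ 64 8 * 9 * 64 ≤ 1) (hrenew : Real.exp 1 * 9 * 64 * K₀ 64 8 ^ 2 * A ≤ E₀)
    (hprop : ∀ (k : ℕ) (g : ℕ → ℝ), g ∈ Window γ → ∀ (i : ℕ), i < k + 1 → ∀ (X : (domSys (F.P K) M (k + 1)).Dom) (φ : CPair (F.P K) 𝔸),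
      φ ∈ sp (k + 1) X →
      (∀ (j : ℕ), j < k + 1 → ∀ (Y : (domSys (F.P K) M j).Dom) (ψ : CPair (F.P K) 𝔸), ψ ∈ sp j Y →
        ∃ (Ec : ℂ → ℂ) (O : Set ℂ), IsOpen O ∧ (∀ t ∈ Ioc (0 : ℝ) γ, closedBall (t : ℂ) r ⊆ O) ∧ DifferentiableOn ℂ Ec O ∧
          (∀ z ∈ O, ‖Ec z‖ ≤ E₀ * Real.exp (-(κ * torusTreeLen Y.1))) ∧
          (∀ t ∈ Ioc (0 : ℝ) γ, Ec t = termC S j Y (Function.update g i t) ψ)) →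
      ∃ (Tc : (S k).Idx → ℂ → ℂ) (O : Set ℂ), IsOpen O ∧ (∀ t ∈ Ioc (0 : ℝ) γ, closedBall (t : ℂ) r ⊆ O) ∧
        (∀ Z : (domSys (F.P K) M (k + 1)).Dom, Z.1 ⊆ X.1 → ∀ j ∈ (S k).idx Z, DifferentiableOn ℂ (Tc j) O) ∧
        (∀ z ∈ O, ∀ Z : (domSys (F.P K) M (k + 1)).Dom, Z.1 ⊆ X.1 →
          ∑ j ∈ (S k).idx Z, ‖Tc j z‖ ≤ A * Real.exp (-(R * torusTreeLen Z.1))) ∧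
        (∀ t ∈ Ioc (0 : ℝ) γ, ∀ j, Tc j t = (S k).T j (restrictPrefix k (Function.update g i t)) φ)) :
    ∀ (k : ℕ) (g : ℕ → ℝ), g ∈ Window γ → ∀ (i : ℕ), i < k + 1 → ∀ (X : (domSys (F.P K) M (k + 1)).Dom) (φ : CPair (F.P K) 𝔸),
      φ ∈ sp (k + 1) X →
      (∀ (j : ℕ), j < k + 1 → ∀ (Y : (domSys (F.P K) M j).Dom) (ψ : CPair (F.P K) 𝔸), ψ ∈ sp j Y →
        ∃ (Ec : ℂ → ℂ) (O : Set ℂ), IsOpen O ∧ (∀ t ∈ Ioc (0 : ℝ) γ, closedBall (t : ℂ) r ⊆ O) ∧ DifferentiableOn ℂ Ec O ∧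
          (∀ z ∈ O, ‖Ec z‖ ≤ E₀ * Real.exp (-(κ * torusTreeLen Y.1))) ∧
          (∀ t ∈ Ioc (0 : ℝ) γ, Ec t = termC S j Y (Function.update g i t) ψ)) →
      ∃ (Ec : ℂ → ℂ) (O : Set ℂ), IsOpen O ∧ (∀ t ∈ Ioc (0 : ℝ) γ, closedBall (t : ℂ) r ⊆ O) ∧ DifferentiableOn ℂ Ec O ∧
        (∀ z ∈ O, ‖Ec z‖ ≤ E₀ * Real.exp (-(κ * torusTreeLen X.1))) ∧
        (∀ t ∈ Ioc (0 : ℝ) γ, Ec t = termC S (k + 1) X (Function.update g i t) φ) := by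
  intro k g hg i hi X φ hφ hIH
  obtain ⟨Tc, O, hO, hdisc, hhol, hmaj, hrepT⟩ := hprop k g hg i hi X φ hφ hIH
  exact strip_succ_of_complexifiedTerms F K S hA0 hr₁ hκ hrate hsmall hrenew k g i X φ Tc O hO hdisc hhol hmaj hrepT

/-- **THE INDUCTION, END TO END: the term-level propagation hypothesis ⟹ STRIP at every level in every coupling** (§2 ∘ §1; `0 ≤ E₀` follows from
the renewal). [folklore] -/
theorem stripBound_termC_of_propagation (S : ClusterTower (F.P K) 𝔸 M)
    (sp : (j : ℕ) → (domSys (F.P K) M j).Dom → Set (CPair (F.P K) 𝔸))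
    {γ r E₀ κ A R r₁ : ℝ} (hr : 0 ≤ r) (hA0 : 0 ≤ A) (hr₁ : 0 ≤ r₁) (hκ : κ ≤ r₁) (hrate : r₁ + 2 * (64 * Real.log 162) + 2 ≤ R)
    (hsmall : A * Real.exp (5 * r₁ + 1) * K₀ 64 8 * 9 * 64 ≤ 1) (hrenew : Real.exp 1 * 9 * 64 * K₀ 64 8 ^ 2 * A ≤ E₀)
    (hprop : ∀ (k : ℕ) (g : ℕ → ℝ), g ∈ Window γ → ∀ (i : ℕ), i < k + 1 → ∀ (X : (domSys (F.P K) M (k + 1)).Dom) (φ : CPair (F.P K) 𝔸),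
      φ ∈ sp (k + 1) X →
      (∀ (j : ℕ), j < k + 1 → ∀ (Y : (domSys (F.P K) M j).Dom) (ψ : CPair (F.P K) 𝔸), ψ ∈ sp j Y →
        ∃ (Ec : ℂ → ℂ) (O : Set ℂ), IsOpen O ∧ (∀ t ∈ Ioc (0 : ℝ) γ, closedBall (t : ℂ) r ⊆ O) ∧ DifferentiableOn ℂ Ec O ∧
          (∀ z ∈ O, ‖Ec z‖ ≤ E₀ * Real.exp (-(κ * torusTreeLen Y.1))) ∧
          (∀ t ∈ Ioc (0 : ℝ) γ, Ec t = termC S j Y (Function.update g i t) ψ)) →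
      ∃ (Tc : (S k).Idx → ℂ → ℂ) (O : Set ℂ), IsOpen O ∧ (∀ t ∈ Ioc (0 : ℝ) γ, closedBall (t : ℂ) r ⊆ O) ∧
        (∀ Z : (domSys (F.P K) M (k + 1)).Dom, Z.1 ⊆ X.1 → ∀ j ∈ (S k).idx Z, DifferentiableOn ℂ (Tc j) O) ∧
        (∀ z ∈ O, ∀ Z : (domSys (F.P K) M (k + 1)).Dom, Z.1 ⊆ X.1 →
          ∑ j ∈ (S k).idx Z, ‖Tc j z‖ ≤ A * Real.exp (-(R * torusTreeLen Z.1))) ∧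
        (∀ t ∈ Ioc (0 : ℝ) γ, ∀ j, Tc j t = (S k).T j (restrictPrefix k (Function.update g i t)) φ)) :
    ∀ (j : ℕ) (g : ℕ → ℝ), g ∈ Window γ → ∀ (i : ℕ) (Y : (domSys (F.P K) M j).Dom) (ψ : CPair (F.P K) 𝔸), ψ ∈ sp j Y →
      ∃ (Ec : ℂ → ℂ) (O : Set ℂ), IsOpen O ∧ (∀ t ∈ Ioc (0 : ℝ) γ, closedBall (t : ℂ) r ⊆ O) ∧ DifferentiableOn ℂ Ec O ∧
        (∀ z ∈ O, ‖Ec z‖ ≤ E₀ * Real.exp (-(κ * torusTreeLen Y.1))) ∧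
        (∀ t ∈ Ioc (0 : ℝ) γ, Ec t = termC S j Y (Function.update g i t) ψ) :=
  have hM : 0 ≤ Real.exp 1 * 9 * 64 * K₀ 64 8 ^ 2 * A := by positivity
  stripBound_termC_of_stepOut S sp hr (le_trans hM hrenew) (stepOut_of_propagation F K S sp hA0 hr₁ hκ hrate hsmall hrenew hprop)

/-! ## §3 Corollaries: (1.18) one run and `DecayBound` for the W1 functional -/

/-- **(1.18) ITSELF, ONE RUN, AS A COROLLARY**: STRIP at every level in every coupling ⟹ `W1.TermBound118 S (Window γ) sp E₀ κ` — `‖E^{(j)}(Y; g; ψ)‖ ≤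
E₀·e^{−κ d_j(Y)}` for every window history, every level, every domain, every configuration of the table (the value at `g` is the value of the
coupling-`j` extension — which does not read `g_j` — at the disc centre `g₀ ∈ ]0, γ]`). [cite: Balaban1987RG1, (1.18) p.263] -/
theorem termBound118_of_stripBound {P : Params} (S : ClusterTower P 𝔸 M) (sp : (j : ℕ) → (domSys P M j).Dom → Set (CPair P 𝔸))
    {γ r E₀ κ : ℝ} (hr : 0 ≤ r)
    (hall : ∀ (j : ℕ) (g : ℕ → ℝ), g ∈ Window γ → ∀ (i : ℕ) (Y : (domSys P M j).Dom) (ψ : CPair P 𝔸), ψ ∈ sp j Y →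
      ∃ (Ec : ℂ → ℂ) (O : Set ℂ), IsOpen O ∧ (∀ t ∈ Ioc (0 : ℝ) γ, closedBall (t : ℂ) r ⊆ O) ∧ DifferentiableOn ℂ Ec O ∧
        (∀ z ∈ O, ‖Ec z‖ ≤ E₀ * Real.exp (-(κ * torusTreeLen Y.1))) ∧
        (∀ t ∈ Ioc (0 : ℝ) γ, Ec t = termC S j Y (Function.update g i t) ψ)) :
    TermBound118 S (Window γ) sp E₀ κ := by
  intro g hg j Y ψ hψ
  obtain ⟨Ec, O, -, hdisc, -, hB, hrep⟩ := hall j g hg j Y ψ hψ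
  have hg0 : g 0 ∈ Ioc (0 : ℝ) γ := hg 0
  have h := hB _ (hdisc (g 0) hg0 (mem_closedBall_self hr))
  rw [hrep (g 0) hg0, termC_congr_prefix S j Y (g := Function.update g j (g 0)) (g' := g)
    (fun m hm => Function.update_of_ne (by omega) _ _) ψ] at h
  exact h

/-- **`DecayBound` FOR THE W1 FUNCTIONAL READ THROUGH `emb`** ([I] (0.25) ∕ (1.18), the real-side binder node N18 ∕ N22 statements read): for
backgrounds whose readings lie in the spaces (`emb U ∈ sp j Y`), `(1.18)` for the terms gives `|Re E^{(j)}(Y; g; emb U)| ≤ E₀·e^{−κ d_j(Y)}` —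
`T4OutputRate.DecayBound (W1.functionalOn S p emb) (Window γ) E₀ κ` (`|Re z| ≤ ‖z‖`). [cite: Balaban1987RG1, (0.25) p.257 and (1.18) p.263] -/
theorem decayBound_functionalOn_of_termBound118 {P : Params} (S : ClusterTower P 𝔸 M) (p : RunPairing) {B : Type} (emb : B → CPair P 𝔸)
    (sp : (j : ℕ) → (domSys P M j).Dom → Set (CPair P 𝔸)) (hsp : ∀ (j : ℕ) (U : B) (Y : (domSys P M j).Dom), emb U ∈ sp j Y)
    {γ E₀ κ : ℝ} (h118 : TermBound118 S (Window γ) sp E₀ κ) :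
    DecayBound (functionalOn S p emb) (Window γ) E₀ κ := by
  rintro g hg U ⟨j, Y⟩
  exact (Complex.abs_re_le_norm _).trans (h118 g hg j Y (emb U) (hsp j U Y))

/-! ## §4 Non-vacuity of the displayed hypothesis (A5 rider) -/

/-- **NON-VACUITY OF `hprop` (A5 rider).**  The term-level propagation hypothesis is SATISFIABLE: the tower with NO terms (`idx Z = ∅`, so every
(2.11)∕(2.26) sum is empty) carries it with `Tc ≡ 0`, `O = ℂ`, for every `A ≥ 0` and every antecedent — so §2–§3 are not vacuous implications.  (Model
tower, NOT NODE 00's: ref-H's WATCH-W1-DEGENERATE — a discharge at a tower not pinned to the (2.14) terms of record is junk-shaped, and this is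
one.) [folklore] -/
theorem propagation_termlessTower {P : Params} (sp : (j : ℕ) → (domSys P M j).Dom → Set (CPair P 𝔸)) {γ r E₀ κ A R : ℝ} (hA : 0 ≤ A) :
    ∀ (k : ℕ) (g : ℕ → ℝ), g ∈ Window γ → ∀ (i : ℕ), i < k + 1 → ∀ (X : (domSys P M (k + 1)).Dom) (φ : CPair P 𝔸), φ ∈ sp (k + 1) X →
      (∀ (j : ℕ), j < k + 1 → ∀ (Y : (domSys P M j).Dom) (ψ : CPair P 𝔸), ψ ∈ sp j Y →
        ∃ (Ec : ℂ → ℂ) (O : Set ℂ), IsOpen O ∧ (∀ t ∈ Ioc (0 : ℝ) γ, closedBall (t : ℂ) r ⊆ O) ∧ DifferentiableOn ℂ Ec O ∧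
          (∀ z ∈ O, ‖Ec z‖ ≤ E₀ * Real.exp (-(κ * torusTreeLen Y.1))) ∧
          (∀ t ∈ Ioc (0 : ℝ) γ, Ec t =
            termC (fun k => (⟨PUnit, fun _ => ∅, fun _ _ _ => 0⟩ : ClusterStep P 𝔸 M k)) j Y (Function.update g i t) ψ)) →
      ∃ (Tc : ((fun k => (⟨PUnit, fun _ => ∅, fun _ _ _ => 0⟩ : ClusterStep P 𝔸 M k)) k).Idx → ℂ → ℂ) (O : Set ℂ),
        IsOpen O ∧ (∀ t ∈ Ioc (0 : ℝ) γ, closedBall (t : ℂ) r ⊆ O) ∧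
        (∀ Z : (domSys P M (k + 1)).Dom, Z.1 ⊆ X.1 →
          ∀ j ∈ ((fun k => (⟨PUnit, fun _ => ∅, fun _ _ _ => 0⟩ : ClusterStep P 𝔸 M k)) k).idx Z, DifferentiableOn ℂ (Tc j) O) ∧
        (∀ z ∈ O, ∀ Z : (domSys P M (k + 1)).Dom, Z.1 ⊆ X.1 →
          ∑ j ∈ ((fun k => (⟨PUnit, fun _ => ∅, fun _ _ _ => 0⟩ : ClusterStep P 𝔸 M k)) k).idx Z, ‖Tc j z‖ ≤
            A * Real.exp (-(R * torusTreeLen Z.1))) ∧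
        (∀ t ∈ Ioc (0 : ℝ) γ, ∀ j, Tc j t =
          ((fun k => (⟨PUnit, fun _ => ∅, fun _ _ _ => 0⟩ : ClusterStep P 𝔸 M k)) k).T j (restrictPrefix k (Function.update g i t)) φ) := by
  intro k g _ i _ X φ _ _
  refine ⟨fun _ _ => 0, Set.univ, isOpen_univ, fun t _ => subset_univ _, fun Z _ j _ => differentiableOn_const 0,
    fun z _ Z _ => ?_, fun t _ j => rfl⟩
  simp only [Finset.sum_empty]
  positivity

end YMDAG.N22.W1

end
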